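import Mathlib
import Summits.Ventures.HodgeRepro2.Tier7.Line3.TorusCompact
import Summits.Ventures.HodgeRepro2.Tier7.Line3.ConcreteLevelFactor

/-!
# Tier7/Line3/TorusIntegral — the second torus is INTEGRAL when the second basis is, and the local representative
is Mathlib's `GeneralLinearGroup.map`
(seat t7-L1-p2, gen 7; plan-3's assignment STATUS l. 15829 — two `[W]`-clauses of l. 15720 (c) as theorems of the datum
«the second basis is integral-unimodular»; TARGET l. 15833)

LINE 3 (t7-plan-3), version (ii). ConcreteLevelFactor p698828 assembles the three `b`-fields of `KappaData` on p1's tori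
with two DISPLAYED binders `hB` / `hB'` («the second torus lies in the integral matrices, with integral inverses» — the
hypothesis under which the level tower is normalised by `T_B`, CongruenceSubgroup p694858) and an abstract local
representative `loc : Orb → GL (Fin 2) F`. This module discharges both from the datum:
* (γ) INTEGRALITY. Over an ultrametric normed field `F` with an isometric involution `σ` and a unit `P ∈ GL₂(F)` whose
  columns are the second basis `f`, every `t ∈ torusB σ f` is `P · diagonal β · P⁻¹` with `N(β j) = β j · σ(β j) = 1`
  (TorusCompact.eq_conjDiag_of_actsOn), so `‖β j‖ = 1` (`norm_eq_one_of_nrm_eq_one`) and, when `P` and `P⁻¹` have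
  entries of absolute value `≤ 1` (`P ∈ GL₂(𝓞)`), the ultrametric product bound `EntryLE.mul` at radius `1 · 1` gives
  `EntryLE normAbv 1 t` (`entryLE_of_mem_torusB`); the two binders follow VERBATIM (`hB_of_integral`, `hB'_of_integral`;
  the inverse of `b` is the element `b⁻¹` of the subgroup).
* (α) THE LOCAL REPRESENTATIVE. «`loc γ = (matO γ).map ψ` as a unit» is Mathlib's `Matrix.GeneralLinearGroup.map ψ :
  GL (Fin 2) E →* GL (Fin 2) F` (the `Units.map` of `ψ.mapMatrix`) — cited, not re-declared; `coe_GL_map` says its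
  matrix is the entrywise image. The consumer `concrete_kappaData_b_fields_of_integral` is ConcreteLevelFactor's
  theorem with `hB` / `hB'` replaced by the datum `hPint` / `hPinv` and instantiated at `Orb := GL (Fin 2) E`,
  `loc := GeneralLinearGroup.map ψ` for an arbitrary ring hom `ψ : E →+* F`; the conclusion is verbatim.
WHAT IT CHANGES IN THE `[W]` COLUMN: the two binders become the DATUM sentence «`P ∈ GL₂(𝓞)` — the hermitian lattice at
`v₁` is unimodular in the basis `f`», and the representative clause becomes a citation of Mathlib's map at
`ψ := algebraMap E (w.adicCompletion E)` (which `ψ`, which `P`: the dictionary, in words). Pure linear algebra and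
ultrametric norms; stated for any `P`, `f` with `hP`. `[M]`-level; NOT distance to (P); residual (a′)/(b′) unchanged in
kind; LEMMAS CLOSING THE STEP 0. DICTIONARY (in words): `F = E_{v₁}`, `σ` its involution, `f` / `P` the local second
basis, `ψ` the completion map at `v₁`. Nothing here is about (N), (P), the real `X`, or HC_CM; §8(d): NO.
Blind lane: Mathlib + the HodgeRepro2 prefix; no sorry; axioms ⊆ {propext, Classical.choice, Quot.sound}.
-/

namespace Summit.Ventures.HodgeRepro2.Tier7.Line3.TorusIntegral

open Matrix MeasureTheory
  Summit.Ventures.HodgeRepro2.T7SupportTwoTorusInvariant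
  Summit.Ventures.HodgeRepro2.Tier7.Line3.CongruenceSubgroup
  Summit.Ventures.HodgeRepro2.Tier7.Line3.LevelTowerTopology
  Summit.Ventures.HodgeRepro2.Tier7.Line3.TorusSupport
  Summit.Ventures.HodgeRepro2.Tier7.Line3.TorusCompact
  Summit.Ventures.HodgeRepro2.Tier7.Line3.LevelFactor
  Summit.Ventures.HodgeRepro2.Tier7.Line3.ConcreteLevelFactor

variable {F : Type*} [NormedField F] (σ : F →+* F)

/-! ## (γ) Integrality of the second torus -/

/-- a scalar of norm one (`x · σ x = 1`) has absolute value one when `σ` is an isometry. -/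
theorem norm_eq_one_of_nrm_eq_one (hσn : ∀ x, ‖σ x‖ = ‖x‖) {x : F} (hx : nrm σ x = 1) : ‖x‖ = 1 := by
  have h : ‖x‖ * ‖x‖ = 1 := by
    have := congrArg norm hx
    rwa [nrm, norm_mul, hσn, norm_one] at this
  rcases mul_self_eq_one_iff.1 h with h1 | h1
  · exact h1
  · linarith [norm_nonneg x]

/-- the diagonal of a vector with entries of absolute value `≤ 1` is integral. -/
theorem entryLE_diagonal (b : Fin 2 → F) (hb : ∀ i, ‖b i‖ ≤ 1) : EntryLE normAbv 1 (diagonal b) := by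
  intro i j
  rw [normAbv_apply, diagonal_apply]
  split_ifs with h
  · exact hb i
  · simp

/-- a product of two integral matrices is integral (ultrametric). -/
theorem entryLE_one_mul [IsUltrametricDist F] {m n : Matrix (Fin 2) (Fin 2) F} (hm : EntryLE normAbv 1 m)
    (hn : EntryLE normAbv 1 n) : EntryLE normAbv 1 (m * n) := by
  have := EntryLE.mul normAbv isNonarchimedean_normAbv zero_le_one hm hn
  rwa [mul_one] at this

variable (f : Fin 2 → Fin 2 → F) (P : GL (Fin 2) F)

/-- the matrix of an element of the second torus is `P · diagonal b · P⁻¹` for its scalars `b`. -/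
theorem coe_eq_mul_diagonal_mul_inv (hP : ∀ j, (P : Matrix (Fin 2) (Fin 2) F).col j = f j) (t : GL (Fin 2) F)
    (b : Fin 2 → F) (hb : ∀ j, b j ≠ 0) (h : ActsOn f (t : Matrix (Fin 2) (Fin 2) F) b) :
    (t : Matrix (Fin 2) (Fin 2) F) =
      (P : Matrix (Fin 2) (Fin 2) F) * diagonal b * ((P⁻¹ : GL (Fin 2) F) : Matrix (Fin 2) (Fin 2) F) := by
  rw [eq_conjDiag_of_actsOn f P hP t b hb h]
  rfl

/-- **every element of the second torus is integral** when `P` and `P⁻¹` are (the datum `P ∈ GL₂(𝓞)`): `t = P · diag(β) · P⁻¹`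
with `‖β j‖ = 1`, and the ultrametric product bound. -/
theorem entryLE_of_mem_torusB [IsUltrametricDist F] (hσn : ∀ x, ‖σ x‖ = ‖x‖)
    (hP : ∀ j, (P : Matrix (Fin 2) (Fin 2) F).col j = f j)
    (hPint : EntryLE normAbv 1 (P : Matrix (Fin 2) (Fin 2) F))
    (hPinv : EntryLE normAbv 1 ((P⁻¹ : GL (Fin 2) F) : Matrix (Fin 2) (Fin 2) F))
    (t : GL (Fin 2) F) (ht : t ∈ torusB σ f) : EntryLE normAbv 1 (t : Matrix (Fin 2) (Fin 2) F) := by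
  obtain ⟨b, hb, hact⟩ := (mem_torusB σ f t).1 ht
  have hb0 : ∀ j, b j ≠ 0 := fun j => ne_zero_of_nrm_eq_one σ (hb j)
  rw [coe_eq_mul_diagonal_mul_inv f P hP t b hb0 hact]
  exact entryLE_one_mul
    (entryLE_one_mul hPint (entryLE_diagonal b fun j => (norm_eq_one_of_nrm_eq_one σ hσn (hb j)).le)) hPinv

/-- **the binder `hB` of ConcreteLevelFactor** as a theorem of the datum `P ∈ GL₂(𝓞)`. -/
theorem hB_of_integral [IsUltrametricDist F] (hσn : ∀ x, ‖σ x‖ = ‖x‖)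
    (hP : ∀ j, (P : Matrix (Fin 2) (Fin 2) F).col j = f j)
    (hPint : EntryLE normAbv 1 (P : Matrix (Fin 2) (Fin 2) F))
    (hPinv : EntryLE normAbv 1 ((P⁻¹ : GL (Fin 2) F) : Matrix (Fin 2) (Fin 2) F)) :
    ∀ b : torusB σ f, EntryLE normAbv 1 ((iotaB σ f b : GL (Fin 2) F) : Matrix (Fin 2) (Fin 2) F) :=
  fun b => entryLE_of_mem_torusB σ f P hσn hP hPint hPinv b b.2

/-- **the binder `hB'` of ConcreteLevelFactor** as a theorem of the datum `P ∈ GL₂(𝓞)`: the inverse of `b` is the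
element `b⁻¹` of the subgroup. -/
theorem hB'_of_integral [IsUltrametricDist F] (hσn : ∀ x, ‖σ x‖ = ‖x‖)
    (hP : ∀ j, (P : Matrix (Fin 2) (Fin 2) F).col j = f j)
    (hPint : EntryLE normAbv 1 (P : Matrix (Fin 2) (Fin 2) F))
    (hPinv : EntryLE normAbv 1 ((P⁻¹ : GL (Fin 2) F) : Matrix (Fin 2) (Fin 2) F)) :
    ∀ b : torusB σ f, EntryLE normAbv 1 (((iotaB σ f b)⁻¹ : GL (Fin 2) F) : Matrix (Fin 2) (Fin 2) F) := by
  intro b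
  rw [← map_inv]
  exact entryLE_of_mem_torusB σ f P hσn hP hPint hPinv _ (b⁻¹).2

/-! ## (α) The local representative is Mathlib's `GeneralLinearGroup.map` -/

variable {E : Type*} [Field E]

/-- the matrix of `GeneralLinearGroup.map ψ γ` is the entrywise image `(γ : M₂ E).map ψ` — «`loc γ = (matO γ).map ψ`
as a unit» is Mathlib's map, no new definition. -/
theorem coe_GL_map (ψ : E →+* F) (γ : GL (Fin 2) E) :
    ((GeneralLinearGroup.map ψ γ : GL (Fin 2) F) : Matrix (Fin 2) (Fin 2) F) =
      (γ : Matrix (Fin 2) (Fin 2) E).map ψ :=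
  rfl

/-- **the three `b`-fields of `KappaData` on the concrete model, with the integrality binders DISCHARGED from the datum
`P ∈ GL₂(𝓞)` and the local representative `GeneralLinearGroup.map ψ`** — ConcreteLevelFactor.concrete_kappaData_b_fields
at `Orb := GL (Fin 2) E`, `loc := GeneralLinearGroup.map ψ`; the conclusion is verbatim. -/
theorem concrete_kappaData_b_fields_of_integral [ProperSpace F] [IsUltrametricDist F] (hσc : Continuous σ)
    (hσn : ∀ x, ‖σ x‖ = ‖x‖) (hP : ∀ j, (P : Matrix (Fin 2) (Fin 2) F).col j = f j)
    (hPint : EntryLE normAbv 1 (P : Matrix (Fin 2) (Fin 2) F))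
    (hPinv : EntryLE normAbv 1 ((P⁻¹ : GL (Fin 2) F) : Matrix (Fin 2) (Fin 2) F))
    {q : ℝ} (hq : 1 < q) (ψ : E →+* F) (χA : torusA σ →* ℂ) (ψB : torusB σ f →* ℂ) (hχA : ∀ a, ‖χA a‖ = 1)
    (hψB : ∀ b, ‖ψB b‖ = 1) (hχA' : IsLocallyConstant (χA : torusA σ → ℂ))
    (hψB' : IsLocallyConstant (ψB : torusB σ f → ℂ)) (γ₀ : GL (Fin 2) E)
    (hmatch : ∀ a b, (iotaA σ a)⁻¹ * GeneralLinearGroup.map ψ γ₀ * iotaB σ f b = GeneralLinearGroup.map ψ γ₀ →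
      χA a * ψB b = 1)
    (arithS : GL (Fin 2) E → Prop) (bS : GL (Fin 2) E → ℂ) (bS_support : ∀ γ, bS γ ≠ 0 → arithS γ) (C : ℝ)
    (size : GL (Fin 2) E → ℝ) (ε : ℝ) (bS_bound : ∀ γ, arithS γ → ‖bS γ‖ ≤ C * (1 + size γ) ^ ε * ‖bS γ₀‖)
    (bS_γ₀ : bS γ₀ ≠ 0) :
    ∃ (mA : MeasurableSpace (torusA σ)) (mB : MeasurableSpace (torusB σ f))
      (μA : Measure (torusA σ)) (μB : Measure (torusB σ f))
      (D : LevelFactorData (torusA σ) (torusB σ f) (GL (Fin 2) F) (GL (Fin 2) E) μA μB),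
      (@BorelSpace (torusA σ) _ mA) ∧ (@BorelSpace (torusB σ f) _ mB) ∧
      μA.IsHaarMeasure ∧ μB.IsHaarMeasure ∧
      D.ιA = iotaA σ ∧ D.ιB = iotaB σ f ∧ D.K = levelTower normAbv isNonarchimedean_normAbv hq ∧
      D.loc = GeneralLinearGroup.map ψ ∧ D.γ₀ = γ₀ ∧ D.arithS = arithS ∧ D.bS = bS ∧ D.size = size ∧ D.ε = ε ∧
      (∀ N γ, D.b N γ ≠ 0 → D.arith N γ) ∧
      (∃ Bb : ℝ, ∀ N γ, D.arith N γ → ‖D.b N γ‖ ≤ Bb * (1 + D.size γ) ^ D.ε * ‖D.b N D.γ₀‖) ∧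
      (∃ N₀ : ℕ, ∀ N ≥ N₀, D.b N D.γ₀ ≠ 0) :=
  concrete_kappaData_b_fields σ hσc hσn f P hP hq (hB_of_integral σ f P hσn hP hPint hPinv)
    (hB'_of_integral σ f P hσn hP hPint hPinv) χA ψB hχA hψB hχA' hψB' (GeneralLinearGroup.map ψ) γ₀ hmatch
    arithS bS bS_support C size ε bS_bound bS_γ₀

end Summit.Ventures.HodgeRepro2.Tier7.Line3.TorusIntegral
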